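import Mathlib

/-!
# P7CertificateZeta32 — the finite arithmetic behind the simple eightfold of proofs/p7-minimal-instances.md §6′

Setting (paper side, not formalised): `L = ℚ(ζ₃₂)`, `Gal(L/ℚ) = (ℤ/32)ˣ = ⟨5⟩ × ⟨-1⟩ ≅ C₈ × C₂`, complex conjugation `= 31 = -1`.
`B` = the simple CM abelian eightfold with CM by `L` and CM type `Φ = {1, 5, 9, 11, 17, 19, 25, 29}`.
`Δ = ⟨7⟩ = {1, 7, 17, 23}` indexes the class `e_Δ = e₁ ∧ e₇ ∧ e₁₇ ∧ e₂₃ ∈ H⁴(B)`.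

Certified here (finite computations by `decide`, standard axioms only):
* `cmType`, `primitive`: `Φ` is a primitive CM type (so `B` is simple with `End⁰(B) = L`);
* `Δ_hodge`: `|Δ ∩ τΦ| = 2` for all 16 `τ` — `e_Δ` is a Hodge class of type (2,2);
* `Δ_subgroup`, `orbit_card`, `stab`: `Δ` is the subgroup `⟨7⟩`, its orbit has 4 elements and stabiliser `⟨7⟩`;
  so the orbit field is `K = L^{⟨7⟩}` (cyclic quartic CM, inside `ℚ(ζ₁₆)` because `17 ∈ ⟨7⟩`);
* `weil_type`: every coset `y⟨7⟩` meets `Φ` in exactly 2 elements — `(B, K)` is of Weil type with `dim_K H¹ = 4`,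
  and `e_Δ` spans (over `ℚ̄`) a `K`-Weil class: the orbit piece is `W_K(B) = Λ⁴_K H¹(B)`;
* `not_weil_qi`, `not_weil_qsqrtm2`: `B` is not of Weil type over `ℚ(i)` (`Gal(L/ℚ(i)) = ⟨5⟩`) nor over `ℚ(√-2)`
  (`Gal(L/ℚ(√-2)) = ⟨3⟩`): the intersections with `Φ` have 6 elements, not 4;
* `no_hodge_pair`: no 2-element subset of `Δ` is balanced;
* the certificate: `χ` is the character with `χ(5) = i`, `χ(-1) = -1` (odd, order 4); `χ_sum_Δ`: it sums to `4 ≠ 0`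
  over `Δ`; `χ_pair`: it sums to `0` over every conjugate pair; `χ_coset`: it sums to `0` over every coset of
  `⟨5⟩` and of `⟨3⟩` — the two index-2 subgroups of `(ℤ/32)ˣ` not containing `-1` (the third one,
  `{1,7,9,15,17,23,25,31} = Gal(L/ℚ(√2))`, contains `31`: `third_contains_conj`).
By Lemma 2.2 / Cor. 2.3 of the paper file, `W_K(B)` therefore meets the algebra generated by divisor classes and
imaginary-quadratic Weil classes on all powers of `B` only in `0`. The passage to Hodge classes is the paper argument.
-/

namespace HodgeRepro0.P7CertificateZeta32

open Finset

/-- `(ℤ/32)ˣ = Gal(ℚ(ζ₃₂)/ℚ)` as an explicit finset. -/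
def U : Finset (ZMod 32) := {1, 3, 5, 7, 9, 11, 13, 15, 17, 19, 21, 23, 25, 27, 29, 31}

/-- The CM type of `B`. -/
def Φ : Finset (ZMod 32) := {1, 5, 9, 11, 17, 19, 25, 29}

/-- The witness `Δ = ⟨7⟩`. -/
def Δ : Finset (ZMod 32) := {1, 7, 17, 23}

/-- `Gal(L/ℚ(i)) = ⟨5⟩ = {a ≡ 1 mod 4}`. -/
def H5 : Finset (ZMod 32) := {1, 5, 9, 13, 17, 21, 25, 29}

/-- `Gal(L/ℚ(√-2)) = ⟨3⟩ = {a ≡ 1, 3 mod 8}`. -/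
def H3 : Finset (ZMod 32) := {1, 3, 9, 11, 17, 19, 25, 27}

/-- `Gal(L/ℚ(√2)) = {a ≡ ±1 mod 8}`, the third index-2 subgroup; it contains complex conjugation. -/
def H7 : Finset (ZMod 32) := {1, 7, 9, 15, 17, 23, 25, 31}

/-- `U` is closed under multiplication. -/
theorem U_mul : ∀ a ∈ U, ∀ b ∈ U, a * b ∈ U := by decide

/-- `Φ` is a CM type: exactly one of `x`, `-x` lies in it. -/
theorem cmType : ∀ x ∈ U, (x ∈ Φ ↔ -x ∉ Φ) := by decide

/-- `Φ` is primitive. -/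
theorem primitive : ∀ h ∈ U, Φ.image (· * h) = Φ → h = 1 := by decide

/-- `Δ = ⟨7⟩` is a subgroup of order 4 not containing `-1`. -/
theorem Δ_subgroup : (∀ a ∈ Δ, ∀ b ∈ Δ, a * b ∈ Δ) ∧ (1 : ZMod 32) ∈ Δ ∧ (31 : ZMod 32) ∉ Δ ∧ Δ.card = 4 := by decide

/-- The balance condition `2 |S ∩ τΦ| = |S|` for all `τ ∈ U`. -/
def IsHodgeSet (S : Finset (ZMod 32)) : Prop := ∀ τ ∈ U, 2 * (S ∩ Φ.image (· * τ)).card = S.card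

/-- The balance condition is decidable. -/
instance (S : Finset (ZMod 32)) : Decidable (IsHodgeSet S) := by unfold IsHodgeSet; infer_instance

/-- `e_Δ` is a Hodge class: the 16-row balance table. -/
theorem Δ_hodge : IsHodgeSet Δ := by decide

/-- The Galois orbit of `Δ` has 4 elements. -/
theorem orbit_card : (U.image (fun τ => Δ.image (· * τ))).card = 4 := by decide

/-- The stabiliser of `Δ` is `⟨7⟩ = Δ` itself. -/
theorem stab : U.filter (fun τ => Δ.image (· * τ) = Δ) = Δ := by decide

/-- Weil type over `K = L^{⟨7⟩}`: every coset `yΔ` meets `Φ` in exactly 2 elements (Hodge numbers (2,2)). -/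
theorem weil_type : ∀ y ∈ U, ((Δ.image (· * y)) ∩ Φ).card = 2 := by decide

/-- `B` is not of Weil type over `ℚ(i)`: `|⟨5⟩ ∩ Φ| = 6 ≠ 4`. -/
theorem not_weil_qi : (H5 ∩ Φ).card = 6 := by decide

/-- `B` is not of Weil type over `ℚ(√-2)`: `|⟨3⟩ ∩ Φ| = 6 ≠ 4`. -/
theorem not_weil_qsqrtm2 : (H3 ∩ Φ).card = 6 := by decide

/-- No 2-element subset of `Δ` is balanced. -/
theorem no_hodge_pair : ∀ a ∈ Δ, ∀ b ∈ Δ, a ≠ b → ¬ IsHodgeSet {a, b} := by decide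

/-- The character `χ` of `(ℤ/32)ˣ` with `χ(5) = i` and `χ(-1) = -1`, tabulated: `x = 5^a (-1)^b ↦ i^a (-1)^b`. -/
def χ (x : ZMod 32) : GaussianInt :=
  if x = 1 then 1 else if x = 5 then ⟨0, 1⟩ else if x = 25 then -1 else if x = 29 then ⟨0, -1⟩ else
  if x = 17 then 1 else if x = 21 then ⟨0, 1⟩ else if x = 9 then -1 else if x = 13 then ⟨0, -1⟩ else
  if x = 31 then -1 else if x = 27 then ⟨0, -1⟩ else if x = 7 then 1 else if x = 3 then ⟨0, 1⟩ else
  if x = 15 then -1 else if x = 11 then ⟨0, -1⟩ else if x = 23 then 1 else if x = 19 then ⟨0, 1⟩ else 0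

/-- `χ` is multiplicative on `U`. -/
theorem χ_mul : ∀ a ∈ U, ∀ b ∈ U, χ (a * b) = χ a * χ b := by decide

/-- `χ` is odd and of order 4. -/
theorem χ_odd : χ 31 = -1 ∧ χ 5 * χ 5 = -1 := by decide

/-- The certificate value `Σ_{x ∈ Δ} χ(x) = 4 ≠ 0` (`χ ≡ 1` on `⟨7⟩`). -/
theorem χ_sum_Δ : Δ.sum χ = 4 ∧ Δ.sum χ ≠ 0 := by decide +kernel

/-- `χ` sums to zero over every conjugate pair. -/
theorem χ_pair : ∀ x ∈ U, χ x + χ (-x) = 0 := by decide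

/-- `H5`, `H3`, `H7` are subgroups of order 8. -/
theorem subgroups :
    (∀ a ∈ H5, ∀ b ∈ H5, a * b ∈ H5) ∧ H5.card = 8 ∧ (∀ a ∈ H3, ∀ b ∈ H3, a * b ∈ H3) ∧ H3.card = 8 ∧
    (∀ a ∈ H7, ∀ b ∈ H7, a * b ∈ H7) ∧ H7.card = 8 := by decide

/-- The third index-2 subgroup contains complex conjugation (so it is the real quadratic subfield `ℚ(√2)`). -/
theorem third_contains_conj : (31 : ZMod 32) ∈ H7 ∧ (31 : ZMod 32) ∉ H5 ∧ (31 : ZMod 32) ∉ H3 := by decide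

/-- `χ` sums to zero over every coset of `⟨5⟩` and of `⟨3⟩`. -/
theorem χ_coset : ∀ y ∈ U, (H5.image (· * y)).sum χ = 0 ∧ (H3.image (· * y)).sum χ = 0 := by decide +kernel

/-- The packaged certificate of §6′ (a)–(d). -/
theorem certificate :
    IsHodgeSet Δ ∧ (∀ y ∈ U, ((Δ.image (· * y)) ∩ Φ).card = 2) ∧
    (∀ a ∈ Δ, ∀ b ∈ Δ, a ≠ b → ¬ IsHodgeSet {a, b}) ∧
    Δ.sum χ ≠ 0 ∧ (∀ x ∈ U, χ x + χ (-x) = 0) ∧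
    (∀ y ∈ U, (H5.image (· * y)).sum χ = 0 ∧ (H3.image (· * y)).sum χ = 0) :=
  ⟨Δ_hodge, weil_type, no_hodge_pair, χ_sum_Δ.2, χ_pair, χ_coset⟩

end HodgeRepro0.P7CertificateZeta32
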